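import Literature.AlgebraicGeometry.Surfaces.NikulinPairOverlattice
import HarnessLib

/-!
# van Geemen–Sarti §1.11, continued: coordinates of `Γ_N = L_γ ⊃ N ⊕ N` and the explicit isometry
# `Γ_N(-1) ≅ Γ₁₆ = D₁₆⁺` ("`(N_i, 0) ↦ e_i + e_{i+8}`, `(0, N_i) ↦ e_i - e_{i+8}`")

[cite: VanGeemenSarti2007, §1.11 ("The lattices `N ⊕ N` and `Γ₁₆`")] [cite: Serre1973, Ch. V §1.4.3 (the lattice `Γ_n`, `n = 4k`)]

Family `hodge`, layer `Literature/AlgebraicGeometry/Surfaces` (namespace `Literature.AlgebraicGeometry.Surfaces`).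
Written for lane `lit-hodgefound` (Track 2 foundations; prover seat `lit-hodgefound-p18`, gen 29, row g29-#11), on top
of `NikulinPairOverlattice.lean` (g29-#10: `nnLattice = Γ_N`, `nnOverlatticeForm`, the residue code). One DEFINITION
with body (`nnDouble`, the doubled coordinates) and THEOREMS; no named fact, no instance, no notation.

## Sources, verbatim

B. van Geemen, A. Sarti, *Nikulin involutions on K3 surfaces*, Math. Z. 255 (2007), §1.10: "`L_γ := {(u, n) ∈
K^* ⊕ N^* : γ(n̄) = ū}`", "`n^* = Σ x_i (N_i/2)` with `Σ x_i ≡ 0 mod 2`" (the dual `N^*`), "`A_N = {x ∈ (ℤ/2ℤ)⁸ :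
Σ x_i = 0}/⟨(1, …, 1)⟩`"; §1.11: "any even unimodular overlattice `L` of `N ⊕ N` such that `N ⊕ {0}` is primitive
in `L`, is isomorphic to `Γ₁₆(-1)` … The embedding `N ⊕ N ↪ Γ₁₆(-1)` is given as: `(N_i, 0) ↦ e_i + e_{i+8}`,
`(0, N_i) ↦ e_i - e_{i+8}` … (note `(N̂, 0) ↦ (Σ e_i)/2 ∈ Γ₁₆`)."
J.-P. Serre, *A Course in Arithmetic*, Ch. V §1.4.3: "`E₁` … the submodule of `E₀ = ℤⁿ` … of `x` with `Σ x_i`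
even … `E` the submodule of `V` generated by `E₁` and by `e = (½, …, ½)` … we denote it by `Γ_n`."
So `2Γ₁₆ = {v ∈ ℤ¹⁶ : (all v_i even or all v_i odd) and Σ v_i ≡ 0 (mod 4)}` (the description used in
`NumberTheory/ModularForms/SiegelThetaSeriesDnPlusLattice.lean`, hypothesis `hrange`).

## What is here

* §1 two more finite checks on the residue code: code words have even weight on each block
  (`nnWord_sum_inl_eq_zero`), and every even-weight diagonal word `(x̄, x̄)` is a code word with an explicit
  preimage (`nnWord_preDiag`).
* §2 **coordinates of `Γ_N`** = van Geemen–Sarti's definition of `L_γ`, `γ = id`: `((Σ x_jN_j)/2, (Σ y_jN_j')/2)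
  ∈ Γ_N` iff `Σ y_j` is even (`∈ N^* ⊕ N^*`) and `x - y` is `≡ 0` or `≡ (1, …, 1)` mod `2` (`ū = n̄` in `A_N`)
  (`nnBaseForm_mk_mem_iff`).
* §3 **`Γ_N(-1) ≅ Γ₁₆` explicitly**: the doubled coordinates `Φ(x/2, y/2) = (x + y, x - y)` (`nnDouble`) are an
  injective `ℤ`-linear map `Γ_N → ℤ⁸ ⊔ ℤ⁸` with `Φ(f)·Φ(g) = -4 (f.g)_Γ` and image exactly `2Γ₁₆`
  (`range_nnDouble`); packaged as `exists_nnLattice_doubledCoordinates_gamma16`. In particular `Φ(N_i, 0) =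
  2(e_i + e_{i+8})/… `: `Φ` realises van Geemen–Sarti's embedding `(N_i,0) ↦ e_i + e_{i+8}`, `(0,N_i') ↦ e_i - e_{i+8}`
  (`nnDouble_node_inl`, `nnDouble_node_inr`) and `Φ(N̂₁) = (1, …, 1) = 2·(Σ e_i)/2` (`nnDouble_hat`).

NOT here: the statement for an arbitrary `γ ∈ O(q_N)` (reduction to `γ = id` via `O(q_N) ≅ S_8`), and the
identification of these coordinates with a Gram matrix of `SiegelThetaSeriesDnPlusLattice.lean` (index type
`Fin 8 ⊕ Fin 8` here, `Fin 16` there).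
-/

noncomputable section

open Module Function Matrix
open LinearMap (BilinForm)
open LinearMap.BilinForm
open Literature.Topology.FourManifolds

namespace Literature.AlgebraicGeometry.Surfaces

/-! ### §1 Two more finite checks on the code -/

set_option maxRecDepth 16000 in
/-- Code words have even weight on the first block (`u ∈ N^*`: "`Σ x_i ≡ 0 mod 2`"). [cite: VanGeemenSarti2007, §1.10 ("`n^* = Σ x_i(N_i/2)` with `Σ x_i ≡ 0 mod 2`")] -/
theorem nnWord_sum_inl_eq_zero : ∀ c : Fin 8 → ZMod 2, ∑ i, nnWord c (Sum.inl i) = 0 := by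
  decide

set_option maxRecDepth 16000 in
/-- Code words have even weight on the second block (`n ∈ N^*`). [cite: VanGeemenSarti2007, §1.10] -/
theorem nnWord_sum_inr_eq_zero : ∀ c : Fin 8 → ZMod 2, ∑ i, nnWord c (Sum.inr i) = 0 := by
  decide

set_option maxRecDepth 16000 in
/-- Every even-weight diagonal word `(x̄, x̄)` is a code word, with preimage `(0, x̄_1, …, x̄_7)` (a finite check).
[cite: VanGeemenSarti2007, §1.11] -/
theorem nnWord_preDiag : ∀ x : Fin 8 → ZMod 2, ∑ i, x i = 0 →
    nnWord (fun k ↦ if k = 0 then 0 else x k) = Sum.elim x x := by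
  decide

/-! ### §2 Coordinates of `Γ_N`: van Geemen–Sarti's `L_γ = {(u, n) ∈ N^* ⊕ N^* : ū = γ(n̄)}` -/

/-- **Diagonal half-vectors**: `((Σ y_jN_j) + (Σ y_jN_j'))/2 ∈ Γ_N` whenever `Σ y_j` is even.
[cite: VanGeemenSarti2007, §1.11 ("`L_γ`", `γ = id`: "`γ(n̄) = ū`")] -/
theorem nnBaseForm_diag_mem {y : Fin 8 → ℤ} (h : Even (∑ j, y j)) : nnBaseForm (y, y) ∈ nnLattice := by
  rw [nnBaseForm_mem_nnLattice_iff]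
  have hsum : ∑ i, ((y i : ℤ) : ZMod 2) = 0 := by
    rw [← Int.cast_sum, ZMod.intCast_zmod_eq_zero_iff_dvd]
    exact_mod_cast even_iff_two_dvd.1 h
  refine ⟨fun k ↦ if k = 0 then 0 else ((y k : ℤ) : ZMod 2), ?_⟩
  rw [nnCodeMap_apply, nnWord_preDiag _ hsum]
  funext i
  rcases i with i | i <;> rfl

/-- `(u, n) ∈ L_γ` for `u - n ∈ N` and `n ∈ N^*`: `((Σ x_jN_j)/2, (Σ y_jN_j')/2) ∈ Γ_N` whenever `x - y` is `≡ 0` or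
`≡ (1, …, 1)` and `Σ y_j` is even. [cite: VanGeemenSarti2007, §1.11 ("`L_γ`")] [cite: VanGeemenSarti2007, §1.10 ("`L_γ := {(u,n) ∈ K^* ⊕ N^* : γ(n̄) = ū}`")] -/
theorem nnBaseForm_mk_mem {x y : Fin 8 → ℤ} (hpar : (∀ j, Even (x j - y j)) ∨ ∀ j, Odd (x j - y j))
    (hsum : Even (∑ j, y j)) : nnBaseForm (x, y) ∈ nnLattice := by
  have h : ((x, y) : NNCarrier) = (x - y, 0) + (y, y) := Prod.ext (by simp) (by simp)
  rw [h, map_add]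
  exact add_mem (nnBaseForm_inl_mem hpar) (nnBaseForm_diag_mem hsum)

/-- Elements of `Γ_N` have `Σ x_j` and `Σ y_j` even (`Γ_N ⊂ N^* ⊕ N^*`). [cite: VanGeemenSarti2007, §1.10 ("`Σ x_i ≡ 0 mod 2`")] -/
theorem even_sum_of_nnBaseForm_mem {w : NNCarrier} (hw : nnBaseForm w ∈ nnLattice) :
    Even (∑ j, w.1 j) ∧ Even (∑ j, w.2 j) := by
  obtain ⟨c, hc⟩ := (nnBaseForm_mem_nnLattice_iff w).1 hw
  rw [nnCodeMap_apply] at hc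
  have h1 := nnWord_sum_inl_eq_zero c
  have h2 := nnWord_sum_inr_eq_zero c
  simp only [hc] at h1 h2
  change ∑ i, ((w.1 i : ℤ) : ZMod 2) = 0 at h1
  change ∑ i, ((w.2 i : ℤ) : ZMod 2) = 0 at h2
  rw [← Int.cast_sum, ZMod.intCast_zmod_eq_zero_iff_dvd] at h1 h2
  exact ⟨even_iff_two_dvd.2 (by exact_mod_cast h1), even_iff_two_dvd.2 (by exact_mod_cast h2)⟩

/-- Elements of `Γ_N` have `x - y ≡ 0` or `≡ (1, …, 1)` (`ū = n̄`). [cite: VanGeemenSarti2007, §1.11] -/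
theorem parity_sub_of_nnBaseForm_mem {w : NNCarrier} (hw : nnBaseForm w ∈ nnLattice) :
    (∀ j, Even (w.1 j - w.2 j)) ∨ ∀ j, Odd (w.1 j - w.2 j) := by
  rcases residue_diag_or_antidiag hw with h | h
  · refine Or.inl fun j ↦ ?_
    have hj := (ZMod.intCast_eq_intCast_iff_dvd_sub _ _ 2).1 (h j)
    rw [Int.even_iff]
    omega
  · refine Or.inr fun j ↦ ?_
    have hj := h j
    rw [← Int.cast_one, ← Int.cast_add, ZMod.intCast_eq_intCast_iff_dvd_sub] at hj
    rw [Int.odd_iff]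
    omega

/-- **Coordinates of `Γ_N` (van Geemen–Sarti's `L_γ`, `γ = id`)**: `((Σ x_jN_j)/2, (Σ y_jN_j')/2) ∈ Γ_N` iff
`x - y ≡ 0` or `≡ (1, …, 1)` mod `2` (`ū = n̄` in `A_N = {Σ x_i = 0}/⟨(1,…,1)⟩`) and `Σ y_j` is even (`n ∈ N^*`; then
`u ∈ N^*` as well). [cite: VanGeemenSarti2007, §1.10 ("`L_γ := {(u,n) ∈ K^* ⊕ N^* : γ(n̄) = ū}`", "`A_N = {x : Σ x_i = 0}/⟨(1,…,1)⟩`")] [cite: VanGeemenSarti2007, §1.11] -/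
theorem nnBaseForm_mk_mem_iff (x y : Fin 8 → ℤ) :
    nnBaseForm (x, y) ∈ nnLattice ↔ ((∀ j, Even (x j - y j)) ∨ ∀ j, Odd (x j - y j)) ∧ Even (∑ j, y j) :=
  ⟨fun h ↦ ⟨parity_sub_of_nnBaseForm_mem h, (even_sum_of_nnBaseForm_mem h).2⟩, fun h ↦ nnBaseForm_mk_mem h.1 h.2⟩

/-! ### §3 The doubled coordinates: `Γ_N(-1) ≅ Γ₁₆` -/

/-- The `i`-th coordinate functionals `X_i(f) = -f(N_i-direction)`: for `f = ((x, y)/2 . _)`, `X_i f = x_i`,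
`Y_i f = y_i`. [cite: VanGeemenSarti2007, §1.11] -/
theorem nnBaseForm_apply_single_inl (w : NNCarrier) (i : Fin 8) : nnBaseForm w (Pi.single i 1, 0) = -w.1 i := by
  rw [nnBaseForm_apply]; simp

/-- Likewise on the second block. [cite: VanGeemenSarti2007, §1.11] -/
theorem nnBaseForm_apply_single_inr (w : NNCarrier) (i : Fin 8) : nnBaseForm w (0, Pi.single i 1) = -w.2 i := by
  rw [nnBaseForm_apply]; simp

/-- **The doubled coordinates `Φ : Γ_N → ℤ⁸ ⊔ ℤ⁸`, `Φ((x, y)/2) = (x + y, x - y)`** — twice van Geemen–Sarti's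
`(N_i, 0) ↦ e_i + e_{i+8}`, `(0, N_i) ↦ e_i - e_{i+8}` extended linearly. [cite: VanGeemenSarti2007, §1.11 ("`(N_i, 0) ↦ e_i + e_{i+8}`, `(0, N_i) ↦ e_i - e_{i+8}`")] -/
def nnDouble : nnLattice →ₗ[ℤ] (NNIndex → ℤ) where
  toFun f := Sum.elim (fun i ↦ -(f.1 (Pi.single i 1, 0)) + -(f.1 (0, Pi.single i 1)))
    (fun i ↦ -(f.1 (Pi.single i 1, 0)) - -(f.1 (0, Pi.single i 1)))
  map_add' f g := by
    funext j
    rcases j with i | i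
    · simp only [Submodule.coe_add, LinearMap.add_apply, Sum.elim_inl, Pi.add_apply]; ring
    · simp only [Submodule.coe_add, LinearMap.add_apply, Sum.elim_inr, Pi.add_apply]; ring
  map_smul' m f := by
    funext j
    rcases j with i | i
    · simp only [Submodule.coe_smul, LinearMap.smul_apply, smul_eq_mul, Sum.elim_inl, Pi.smul_apply, RingHom.id_apply]
      ring
    · simp only [Submodule.coe_smul, LinearMap.smul_apply, smul_eq_mul, Sum.elim_inr, Pi.smul_apply, RingHom.id_apply]
      ring

/-- `Φ((x, y)/2) = (x + y, x - y)`. [cite: VanGeemenSarti2007, §1.11] -/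
theorem nnDouble_mk (w : NNCarrier) (hw : nnBaseForm w ∈ nnLattice) :
    nnDouble ⟨nnBaseForm w, hw⟩ = Sum.elim (w.1 + w.2) (w.1 - w.2) := by
  funext j
  rcases j with i | i
  · change -(nnBaseForm w (Pi.single i 1, 0)) + -(nnBaseForm w (0, Pi.single i 1)) = (w.1 + w.2) i
    rw [nnBaseForm_apply_single_inl, nnBaseForm_apply_single_inr, neg_neg, neg_neg, Pi.add_apply]
  · change -(nnBaseForm w (Pi.single i 1, 0)) - -(nnBaseForm w (0, Pi.single i 1)) = (w.1 - w.2) i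
    rw [nnBaseForm_apply_single_inl, nnBaseForm_apply_single_inr, neg_neg, neg_neg, Pi.sub_apply]

/-- **`Φ(N_i, 0) = 2(e_i + e_{i+8})`.** [cite: VanGeemenSarti2007, §1.11 ("`(N_i, 0) ↦ e_i + e_{i+8}`")] -/
theorem nnDouble_node_inl (i : Fin 8) :
    nnDouble (nnNodeForm.toOverlattice nnLattice range_nnNodeForm_le (Pi.single i 1, 0)) =
      (2 : ℤ) • Sum.elim (Pi.single i 1) (Pi.single i 1) := by
  have h : nnNodeForm.toOverlattice nnLattice range_nnNodeForm_le (Pi.single i 1, 0) =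
      ⟨nnBaseForm ((2 : ℤ) • (Pi.single i 1, 0)), by rw [map_smul]; exact range_nnNodeForm_le ⟨_, rfl⟩⟩ := by
    apply Subtype.ext
    change nnNodeForm (Pi.single i 1, 0) = nnBaseForm ((2 : ℤ) • (Pi.single i 1, 0))
    rw [map_smul]; rfl
  rw [h, nnDouble_mk]
  funext j
  rcases j with j | j <;> simp [two_mul]

/-- **`Φ(0, N_i') = 2(e_i - e_{i+8})`.** [cite: VanGeemenSarti2007, §1.11 ("`(0, N_i) ↦ e_i - e_{i+8}`")] -/
theorem nnDouble_node_inr (i : Fin 8) :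
    nnDouble (nnNodeForm.toOverlattice nnLattice range_nnNodeForm_le (0, Pi.single i 1)) =
      (2 : ℤ) • Sum.elim (Pi.single i 1) (-Pi.single i 1) := by
  have h : nnNodeForm.toOverlattice nnLattice range_nnNodeForm_le (0, Pi.single i 1) =
      ⟨nnBaseForm ((2 : ℤ) • (0, Pi.single i 1)), by rw [map_smul]; exact range_nnNodeForm_le ⟨_, rfl⟩⟩ := by
    apply Subtype.ext
    change nnNodeForm (0, Pi.single i 1) = nnBaseForm ((2 : ℤ) • (0, Pi.single i 1))
    rw [map_smul]; rfl
  rw [h, nnDouble_mk]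
  funext j
  rcases j with j | j <;> simp [two_mul]

/-- **`Φ(N̂₁) = (1, …, 1) = 2 · (Σ_{i=1}^{16} e_i)/2`.** [cite: VanGeemenSarti2007, §1.11 ("note `(N̂, 0) ↦ (Σ e_i)/2 ∈ Γ₁₆`")] -/
theorem nnDouble_hat : nnDouble ⟨nnBaseForm (1, 0), nnBaseForm_one_zero_mem⟩ = 1 := by
  rw [nnDouble_mk]
  funext j
  rcases j with j | j <;> simp

/-- `Sum.elim`-vectors pair blockwise. [folklore] -/
private theorem sum_elim_dotProduct (a b c d : Fin 8 → ℤ) :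
    Sum.elim a b ⬝ᵥ Sum.elim c d = a ⬝ᵥ c + b ⬝ᵥ d :=
  sumElim_dotProduct_sumElim a c b d

/-- **`Φ` is an isometry `Γ_N(-1) → ¼·(standard form)`, i.e. `Φ(f)·Φ(g) = -4 (f.g)_Γ`** (`(x+y)·(x'+y') +
(x-y)·(x'-y') = 2(x·x' + y·y') = -2 (w.w')_{Λ₀'} = -4 (w/2 . w'/2)_Γ`). [cite: VanGeemenSarti2007, §1.11 ("`N ⊕ N ↪ Γ₁₆(-1)`")] -/
theorem nnDouble_dotProduct (f g : nnLattice) : nnDouble f ⬝ᵥ nnDouble g = -(4 * nnOverlatticeForm f g) := by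
  obtain ⟨f, hf⟩ := f
  obtain ⟨g, hg⟩ := g
  obtain ⟨w, rfl⟩ := exists_eq_nnBaseForm f
  obtain ⟨w', rfl⟩ := exists_eq_nnBaseForm g
  have h2 := two_mul_nnOverlatticeForm_mk w w' hf hg
  rw [nnBaseForm_apply] at h2
  rw [nnDouble_mk, nnDouble_mk, sum_elim_dotProduct, add_dotProduct, dotProduct_add, dotProduct_add, sub_dotProduct,
    dotProduct_sub, dotProduct_sub]
  linarith [dotProduct_comm w.1 w'.2, dotProduct_comm w.2 w'.1]

/-- **`Φ` is injective.** [cite: VanGeemenSarti2007, §1.11] -/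
theorem nnDouble_injective : Injective nnDouble := by
  refine (injective_iff_map_eq_zero _).2 fun f hf ↦ ?_
  obtain ⟨f, hfm⟩ := f
  obtain ⟨w, rfl⟩ := exists_eq_nnBaseForm f
  rw [nnDouble_mk] at hf
  have h1 : w.1 + w.2 = 0 := funext fun i ↦ by simpa using congrFun hf (Sum.inl i)
  have h2 : w.1 - w.2 = 0 := funext fun i ↦ by simpa using congrFun hf (Sum.inr i)
  have hw1 : w.1 = 0 := by
    funext i
    have := congrFun h1 i
    have := congrFun h2 i
    simp only [Pi.add_apply, Pi.sub_apply, Pi.zero_apply] at *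
    omega
  have hw2 : w.2 = 0 := by
    rw [hw1, zero_add] at h1
    exact h1
  have hw : w = 0 := Prod.ext hw1 hw2
  apply Subtype.ext
  change nnBaseForm w = 0
  rw [hw, map_zero]

/-- **The image of `Φ` is `2Γ₁₆ = {v : all `v_i` even or all odd, `Σ v_i ≡ 0 (mod 4)}`** (Serre's `Γ₁₆ = E₁ + ℤ·(½,…,½)`,
doubled). [cite: Serre1973, Ch. V §1.4.3 ("`E₁` … `Σ x_i` even … `E` generated by `E₁` and by `e = (½, …, ½)`")] [cite: VanGeemenSarti2007, §1.11 ("is isomorphic to `Γ₁₆(-1)`")] -/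
theorem range_nnDouble :
    Set.range nnDouble = {v : NNIndex → ℤ | ((∀ i, Even (v i)) ∨ ∀ i, Odd (v i)) ∧ (4 : ℤ) ∣ ∑ i, v i} := by
  ext v
  constructor
  · rintro ⟨⟨f, hfm⟩, rfl⟩
    obtain ⟨w, rfl⟩ := exists_eq_nnBaseForm f
    rw [nnDouble_mk]
    obtain ⟨hs1, -⟩ := even_sum_of_nnBaseForm_mem hfm
    refine ⟨?_, ?_⟩
    · rcases parity_sub_of_nnBaseForm_mem hfm with h | h
      · refine Or.inl fun i ↦ ?_
        rcases i with i | i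
        · have : (w.1 + w.2) i = (w.1 i - w.2 i) + 2 * w.2 i := by simp; ring
          rw [Sum.elim_inl, this]
          exact (h i).add (even_two_mul _)
        · exact h i
      · refine Or.inr fun i ↦ ?_
        rcases i with i | i
        · have : (w.1 + w.2) i = (w.1 i - w.2 i) + 2 * w.2 i := by simp; ring
          rw [Sum.elim_inl, this]
          exact (h i).add_even (even_two_mul _)
        · exact h i
    · rw [Fintype.sum_sum_type]
      simp only [Sum.elim_inl, Sum.elim_inr, Pi.add_apply, Pi.sub_apply]
      rw [Finset.sum_add_distrib, Finset.sum_sub_distrib]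
      obtain ⟨m, hm⟩ := hs1
      exact ⟨m, by rw [hm]; ring⟩
  · rintro ⟨hpar, hsum⟩
    -- `a = v|₁`, `b = v|₂`, `a ≡ b`; `x = (a + b)/2`, `y = (a - b)/2`
    have hab : ∀ i, Even (v (Sum.inl i) + v (Sum.inr i)) ∧ Even (v (Sum.inl i) - v (Sum.inr i)) := fun i ↦ by
      rcases hpar with h | h
      · exact ⟨(h _).add (h _), (h _).sub (h _)⟩
      · exact ⟨(h _).add_odd (h _), (h _).sub_odd (h _)⟩
    choose s hs using fun i ↦ (hab i).1
    choose t ht using fun i ↦ (hab i).2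
    -- `v|₁ = s + t`, `v|₂ = s - t`
    have hv1 : ∀ i, v (Sum.inl i) = s i + t i := fun i ↦ by have := hs i; have := ht i; omega
    have hv2 : ∀ i, v (Sum.inr i) = s i - t i := fun i ↦ by have := hs i; have := ht i; omega
    have hb : Even (∑ i, v (Sum.inr i)) := by
      rcases hpar with h | h
      · exact Finset.even_sum (fun i ↦ v (Sum.inr i)) fun i _ ↦ h _
      · have h8 : ∑ i : Fin 8, v (Sum.inr i) = ∑ i : Fin 8, (v (Sum.inr i) - 1) + 8 := by
          rw [Finset.sum_sub_distrib]; simp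
        rw [h8]
        exact (Finset.even_sum (fun i ↦ v (Sum.inr i) - 1) fun i _ ↦ (h _).sub_odd odd_one).add (by decide)
    have hst : (∀ j, Even (s j - t j)) ∨ ∀ j, Odd (s j - t j) := by
      rcases hpar with h | h
      · exact Or.inl fun j ↦ by rw [← hv2]; exact h _
      · exact Or.inr fun j ↦ by rw [← hv2]; exact h _
    have htsum : Even (∑ j, t j) := by
      -- `Σ v = Σ v|₁ + Σ v|₂ = 2 Σ s ≡ 0 (mod 4)`, so `Σ s` is even, and `Σ t = Σ s - Σ v|₂`
      have hA : ∑ i, v (Sum.inl i) = ∑ j, s j + ∑ j, t j := by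
        rw [← Finset.sum_add_distrib]; exact Finset.sum_congr rfl fun i _ ↦ hv1 i
      have hB : ∑ i, v (Sum.inr i) = ∑ j, s j - ∑ j, t j := by
        rw [← Finset.sum_sub_distrib]; exact Finset.sum_congr rfl fun i _ ↦ hv2 i
      have hC : ∑ i, v i = ∑ i, v (Sum.inl i) + ∑ i, v (Sum.inr i) := Fintype.sum_sum_type _
      obtain ⟨m, hm⟩ := hsum
      obtain ⟨k, hk⟩ := hb
      exact ⟨m - k, by omega⟩
    refine ⟨⟨nnBaseForm (s, t), nnBaseForm_mk_mem hst htsum⟩, ?_⟩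
    rw [nnDouble_mk]
    funext i
    rcases i with i | i
    · rw [Sum.elim_inl, Pi.add_apply, hv1]
    · rw [Sum.elim_inr, Pi.sub_apply, hv2]

/-- **van Geemen–Sarti §1.11 for `γ = id`: `Γ_N(-1) ≅ Γ₁₆`** — there is an injective `ℤ`-linear map
`Φ : Γ_N → ℤ⁸ ⊔ ℤ⁸` with image `2Γ₁₆ = {v : v ≡ 0 or v ≡ (1,…,1) (mod 2), Σ v_i ≡ 0 (mod 4)}` and
`Φ(f)·Φ(g) = -4 (f.g)_Γ`, i.e. `f ↦ Φ(f)/2` is an isometry of `Γ_N(-1)` onto Serre's `Γ₁₆ = D₁₆⁺`.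
[cite: VanGeemenSarti2007, §1.11 ("is isomorphic to `Γ₁₆(-1)`", "`(N_i, 0) ↦ e_i + e_{i+8}`, `(0, N_i) ↦ e_i - e_{i+8}`")] [cite: Serre1973, Ch. V §1.4.3] -/
theorem exists_nnLattice_doubledCoordinates_gamma16 :
    ∃ Φ : nnLattice →ₗ[ℤ] (NNIndex → ℤ), Injective Φ ∧
      Set.range Φ = {v | ((∀ i, Even (v i)) ∨ ∀ i, Odd (v i)) ∧ (4 : ℤ) ∣ ∑ i, v i} ∧
      ∀ f g, Φ f ⬝ᵥ Φ g = -(4 * nnOverlatticeForm f g) :=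
  ⟨nnDouble, nnDouble_injective, range_nnDouble, nnDouble_dotProduct⟩

end Literature.AlgebraicGeometry.Surfaces
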